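import Literature.AlgebraicGeometry.Frobenioids.PerfectionSquareUnique
import Literature.AnabelianGeometry.EtaleTheta.BiKummerThm44SubBiratPerfection
import Literature.AnabelianGeometry.EtaleTheta.Discharge.Sec3Cor38CriterionSlice

/-!
# [EtTh] Theorem 4.4 (ii), sub-DAG row T44-L11: the perfection square of `Ψ` with print's `1`-uniqueness in the
# structure-compatible sense — proof-only companion

S. Mochizuki, *The étale theta function and its Frobenioid-theoretic manifestations*, Publ. RIMS **45**
(2009) [MochizukiEtTh2009], §4, proof of Theorem 4.4, p.95 (printed p.321): "`Ψ` is compatible with the operation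
of passing to the perfection [cf. Theorem 3.7, (i), (ii); [FrdI], Theorem 3.4, (iii)]"; [FrdI] Thm 3.4 (iii): "`Ψ`
induces a `1`-unique functor `Ψ^pf : C₁^pf → C₂^pf` that fits into a `1`-commutative diagram".

Cell abc-iut, layer L2, cone node `EtTh:Thm4.4(ii)`, sub-DAG `plan/L2/SUBDAG-EtTh-Thm44.md` row T44-L11; seat
abc-iut-w6-d079 (W6 tranche 2).  PROOF-ONLY (no definition, no named fact, nothing restated).  Sequel of
`BiKummerThm44SubBiratPerfection.lean` (`Thm44Hyp.isFrobeniusCompatible`, `perfectionMap_isEquivalence`,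
`oneCommutes_perfection`), which left the `1`-uniqueness conjunct of the perfection square unasserted.  Here it is
PROVED in the cell's structure-compatible reading of "`1`-unique" (the reading adopted for row C38-L03′ of
`plan/L2/SUBDAG-EtTh-Cor38.md`, `Cor38Hyp.CompatibleWithPerfectionR`): `Ψ^pf := Perfection.map` is unique up to
isomorphism among the functors `C₁^pf → C₂^pf` that carry arrows of Frobenius type to arrows of Frobenius type of
the same Frobenius degree and fit into the square — abc-iut-L1's `PreFrobenioid.Perfection.pfSquareR_map`
(`PerfectionSquareUnique.lean`), whose input "`C₂` of Frobenius-isotropic type" is Thm 3.7 (i)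
(`TemperedFrobenioid.isOfType_isFrobeniusIsotropic`).  (The naked-functor `OneUniqueSquare` for the perfection
square is the form abc-iut-L1 shows NOT to hold in general, `PerfectionSquareNotOneUnique.lean`; it is not
asserted.)

* `Thm44Hyp.pfSquareR` — ANY pair of settings, inputs "`C_i` Frobenioid" + T44-L03: equivalence ∧ square ∧
  structure-compatible `1`-uniqueness;
* `Thm44Hyp.exists_pfEquivalence_unique` — print's wording (∃ an equivalence `Ψ^pf` fitting the square, `1`-unique);
* `Thm44Hyp.exists_pfEquivalence_unique_treeVocab` — at the tree vocabularies ⇐ {Rmk 3.7.2 (`Remark372 D₀ / D₀'`),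
  `hBmon₁ / hBmon₂`} ONLY (covers abc-iut-L2-t4's genuine connected base `mkOfConnectedTemperoid`).

HONEST FRAMING: refereed pre-IUT material ([EtTh] §4 over [FrdI] §3); nothing here asserts that such data exist
for an actual curve or bears on the disputed [IUTchIII] Cor. 3.12; typed ≠ proved — here PROVED.
-/

noncomputable section

namespace Literature.AnabelianGeometry.EtaleTheta

open CategoryTheory Opposite Literature.AlgebraicGeometry.Frobenioids

namespace BiKummerSetting

universe u₀ v₀ u v w

section AnySetting

variable {K : Type u₀} [Field K] {K' : Type u₀} [Field K'] {D₀ : Type u₀} [Category.{v₀} D₀]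
  {V : FrdIMonoidStub.{w}}
  {X₁ : SemiGraphs.TemperedArithmeticGroup.{u₀} K} {X₂ : SemiGraphs.TemperedArithmeticGroup.{u₀} K'}
  {D₀' : Type u₀} [Category.{v₀} D₀']
  {T₁ : RealifiedDivisorMonoids (D₀ := D₀) V} {T₂ : RealifiedDivisorMonoids (D₀ := D₀') V}
  {D₁ D₂ : Type u} [Category.{v} D₁] [Category.{v} D₂] {VD₁ : FrdICatStub.{u, v, w} D₁}
  {VD₂ : FrdICatStub.{u, v, w} D₂} {S₁ : BiKummerSetting X₁ T₁ D₁ VD₁} {S₂ : BiKummerSetting X₂ T₂ D₂ VD₂}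

/-- **T44-L11 with print's `1`-uniqueness, structure-compatible form** ("[FrdI] Thm 3.4 (iii): `Ψ` induces a
`1`-unique functor `Ψ^pf : C₁^pf → C₂^pf` that fits into a `1`-commutative diagram"), for ANY pair of settings, from
"`C_i` is a Frobenioid" and T44-L03: `Ψ^pf := Perfection.map` is an equivalence, `Ψ ⋙ (C₂ → C₂^pf) ≅ (C₁ → C₁^pf) ⋙ Ψ^pf`,
and every `B′ : C₁^pf ⥤ C₂^pf` carrying arrows of Frobenius type to arrows of Frobenius type of the same degree and
fitting into the square is `≅ Ψ^pf` (abc-iut-L1's `Perfection.pfSquareR_map`; "`C₂` of Frobenius-isotropic type" by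
Thm 3.7 (i), `TemperedFrobenioid.isOfType_isFrobeniusIsotropic`). [cite: MochizukiEtTh2009, Thm 4.4 (ii) p.95] -/
theorem Thm44Hyp.pfSquareR (h : Thm44Hyp S₁ S₂) (hF₁ : PreFrobenioid.IsFrobenioid S₁.F)
    (hF₂ : PreFrobenioid.IsFrobenioid S₂.F) (h3 : h.PreservesFrobeniusStructure) :
    (PreFrobenioid.Perfection.map (hF₁ := hF₁) (hF₂ := hF₂) (h.isFrobeniusCompatible h3)).IsEquivalence ∧
      OneCommutes h.Ψ.functor (PreFrobenioid.Perfection.toPf hF₂) (PreFrobenioid.Perfection.toPf hF₁)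
        (PreFrobenioid.Perfection.map (hF₁ := hF₁) (hF₂ := hF₂) (h.isFrobeniusCompatible h3)) ∧
      ∀ B' : PreFrobenioid.Perfection hF₁ ⥤ PreFrobenioid.Perfection hF₂,
        PreFrobenioidData.PreservesMor B' (PreFrobenioid.Perfection.ops hF₁).IsFrobeniusType
            (PreFrobenioid.Perfection.ops hF₂).IsFrobeniusType →
          (∀ ⦃X Y : PreFrobenioid.Perfection hF₁⦄ (f : X ⟶ Y), (PreFrobenioid.Perfection.ops hF₁).IsFrobeniusType f →
            (PreFrobenioid.Perfection.ops hF₂).degFr (B'.map f) = (PreFrobenioid.Perfection.ops hF₁).degFr f) →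
          OneCommutes h.Ψ.functor (PreFrobenioid.Perfection.toPf hF₂) (PreFrobenioid.Perfection.toPf hF₁) B' →
          Nonempty (B' ≅ PreFrobenioid.Perfection.map (hF₁ := hF₁) (hF₂ := hF₂) (h.isFrobeniusCompatible h3)) :=
  PreFrobenioid.Perfection.pfSquareR_map (hF₁ := hF₁) (hF₂ := hF₂) (S₂.tf.isOfType_isFrobeniusIsotropic hF₂)
    h.Ψ (h.isFrobeniusCompatible h3)

/-- **T44-L11 in print's wording with the structure-compatible `1`-uniqueness**: there is an equivalence
`Ψ^pf : C₁^pf ⥲ C₂^pf` fitting into the `1`-commutative square with `C_i → C_i^pf`, unique up to isomorphism among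
the functors compatible with arrows of Frobenius type / Frobenius degrees that fit into the square.
[cite: MochizukiEtTh2009, Thm 4.4 (ii) p.95] -/
theorem Thm44Hyp.exists_pfEquivalence_unique (h : Thm44Hyp S₁ S₂) (hF₁ : PreFrobenioid.IsFrobenioid S₁.F)
    (hF₂ : PreFrobenioid.IsFrobenioid S₂.F) (h3 : h.PreservesFrobeniusStructure) :
    ∃ Ψpf : PreFrobenioid.Perfection hF₁ ≌ PreFrobenioid.Perfection hF₂,
      OneCommutes h.Ψ.functor (PreFrobenioid.Perfection.toPf hF₂) (PreFrobenioid.Perfection.toPf hF₁) Ψpf.functor ∧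
        ∀ B' : PreFrobenioid.Perfection hF₁ ⥤ PreFrobenioid.Perfection hF₂,
          PreFrobenioidData.PreservesMor B' (PreFrobenioid.Perfection.ops hF₁).IsFrobeniusType
              (PreFrobenioid.Perfection.ops hF₂).IsFrobeniusType →
            (∀ ⦃X Y : PreFrobenioid.Perfection hF₁⦄ (f : X ⟶ Y),
                (PreFrobenioid.Perfection.ops hF₁).IsFrobeniusType f →
                  (PreFrobenioid.Perfection.ops hF₂).degFr (B'.map f) = (PreFrobenioid.Perfection.ops hF₁).degFr f) →
            OneCommutes h.Ψ.functor (PreFrobenioid.Perfection.toPf hF₂) (PreFrobenioid.Perfection.toPf hF₁) B' →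
            Nonempty (B' ≅ Ψpf.functor) := by
  obtain ⟨hequiv, hcomm, huniq⟩ := h.pfSquareR hF₁ hF₂ h3
  haveI := hequiv
  exact ⟨(PreFrobenioid.Perfection.map (hF₁ := hF₁) (hF₂ := hF₂) (h.isFrobeniusCompatible h3)).asEquivalence,
    hcomm, huniq⟩

end AnySetting

section TreeVocab

variable {K : Type u₀} [Field K] {K' : Type u₀} [Field K'] {D₀ : Type u₀} [Category.{v₀} D₀]
  {X₁ : SemiGraphs.TemperedArithmeticGroup.{u₀} K} {X₂ : SemiGraphs.TemperedArithmeticGroup.{u₀} K'}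
  {D₀' : Type u₀} [Category.{v₀} D₀']
  {T₁ : RealifiedDivisorMonoids (D₀ := D₀) treeMonoidVocab.{w}}
  {T₂ : RealifiedDivisorMonoids (D₀ := D₀') treeMonoidVocab.{w}}
  {D₁ D₂ : Type u} [Category.{v} D₁] [Category.{v} D₂]
  {IsRational₁ IsStrictlyRational₁ : (D₁ᵒᵖ ⥤ CommMonCat.{w}) → Prop}
  {IsRational₂ IsStrictlyRational₂ : (D₂ᵒᵖ ⥤ CommMonCat.{w}) → Prop}
  {S₁ : BiKummerSetting X₁ T₁ D₁ (treeCatVocab D₁ IsRational₁ IsStrictlyRational₁)}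
  {S₂ : BiKummerSetting X₂ T₂ D₂ (treeCatVocab D₂ IsRational₂ IsStrictlyRational₂)}

/-- **T44-L11 with the structure-compatible `1`-uniqueness, at the tree vocabularies** ⇐ {Rmk 3.7.2, `hBmon`} (this
covers abc-iut-L2-t4's genuine connected base `mkOfConnectedTemperoid`, an instance of these vocabularies).
[cite: MochizukiEtTh2009, Thm 4.4 (ii) p.95] -/
theorem Thm44Hyp.exists_pfEquivalence_unique_treeVocab (h : Thm44Hyp S₁ S₂)
    (h372 : TemperedFrobenioid.Remark372 D₀) (h372' : TemperedFrobenioid.Remark372 D₀')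
    (hBmon₁ : IsMonoidOn S₁.tf.ratFnFunctor) (hBmon₂ : IsMonoidOn S₂.tf.ratFnFunctor) :
    ∃ Ψpf : PreFrobenioid.Perfection (S₁.tf.isFrobenioid_treeCatVocab_of_isMonoidOn hBmon₁) ≌
        PreFrobenioid.Perfection (S₂.tf.isFrobenioid_treeCatVocab_of_isMonoidOn hBmon₂),
      OneCommutes h.Ψ.functor (PreFrobenioid.Perfection.toPf (S₂.tf.isFrobenioid_treeCatVocab_of_isMonoidOn hBmon₂))
          (PreFrobenioid.Perfection.toPf (S₁.tf.isFrobenioid_treeCatVocab_of_isMonoidOn hBmon₁)) Ψpf.functor ∧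
        ∀ B' : PreFrobenioid.Perfection (S₁.tf.isFrobenioid_treeCatVocab_of_isMonoidOn hBmon₁) ⥤
            PreFrobenioid.Perfection (S₂.tf.isFrobenioid_treeCatVocab_of_isMonoidOn hBmon₂),
          PreFrobenioidData.PreservesMor B'
              (PreFrobenioid.Perfection.ops (S₁.tf.isFrobenioid_treeCatVocab_of_isMonoidOn hBmon₁)).IsFrobeniusType
              (PreFrobenioid.Perfection.ops (S₂.tf.isFrobenioid_treeCatVocab_of_isMonoidOn hBmon₂)).IsFrobeniusType →
            (∀ ⦃X Y : PreFrobenioid.Perfection (S₁.tf.isFrobenioid_treeCatVocab_of_isMonoidOn hBmon₁)⦄ (f : X ⟶ Y),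
                (PreFrobenioid.Perfection.ops (S₁.tf.isFrobenioid_treeCatVocab_of_isMonoidOn hBmon₁)).IsFrobeniusType f →
                  (PreFrobenioid.Perfection.ops (S₂.tf.isFrobenioid_treeCatVocab_of_isMonoidOn hBmon₂)).degFr (B'.map f) =
                    (PreFrobenioid.Perfection.ops (S₁.tf.isFrobenioid_treeCatVocab_of_isMonoidOn hBmon₁)).degFr f) →
            OneCommutes h.Ψ.functor
                (PreFrobenioid.Perfection.toPf (S₂.tf.isFrobenioid_treeCatVocab_of_isMonoidOn hBmon₂))
                (PreFrobenioid.Perfection.toPf (S₁.tf.isFrobenioid_treeCatVocab_of_isMonoidOn hBmon₁)) B' →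
            Nonempty (B' ≅ Ψpf.functor) :=
  h.exists_pfEquivalence_unique _ _ (h.preservesFrobeniusStructure_treeVocab h372 h372' hBmon₁ hBmon₂)

end TreeVocab

end BiKummerSetting

end Literature.AnabelianGeometry.EtaleTheta
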